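import Mathlib
import Summits.Ventures.PercRepro2.HCov
import Summits.Ventures.PercRepro2.RootLeafUPocketFacts
import Summits.Ventures.PercRepro2.RootLeafUPocketAtoms
import Summits.Ventures.PercRepro2.RootLeafUPocketC44

/-!
# Cells lemmas for the o-pocket bridge, part 23 of 23 (blind cell PercRepro2, p4 g20; generated text, no definitions)

Every pocket event used by the BHK 1.3 / 1.4 / Harris facts of the 57 o-pocket certificates is a disjoint union of the fifteen atoms of
the pocket copy `inn` on `{u, a₂, c, b}` (RootLeafUPocketAtoms `atoms_cover`); its probability is the sum of the atom probabilities.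
Generic in the four vertex names: the o-pocket instance is `c := o`.
-/

namespace Summit.Ventures.PercRepro2

open UnionCluster CovForm

namespace RootLeafU

namespace PocketBridge

variable {V : Type*} {E : Type*}
variable {ends : E → Sym2 V} {P : Set V} {u a₂ c b : V} {inn : Config E → Config E}
variable [Fintype E] [DecidableEq E] {R : Type*} [CommRing R] (p : E → R)

/-- cells: `cellsO_108` as a sum of atoms (4 atoms). -/
theorem cellsO_108 :
    prob p {ω : Config E | inn ω ∈ {ω' : Config E | ¬ Conn ends ω' u a₂ ∧ ¬ Conn ends ω' u c} ∩ {ω' : Config E | ¬ Conn ends ω' u a₂ ∧ ¬ Conn ends ω' a₂ c}} = prob p {ω : Config E | inn ω ∈ {ω' : Config E | ¬ Conn ends ω' u a₂ ∧ ¬ Conn ends ω' u c ∧ Conn ends ω' u b ∧ ¬ Conn ends ω' a₂ c ∧ ¬ Conn ends ω' a₂ b ∧ ¬ Conn ends ω' c b}} + prob p {ω : Config E | inn ω ∈ {ω' : Config E | ¬ Conn ends ω' u a₂ ∧ ¬ Conn ends ω' u c ∧ ¬ Conn ends ω' u b ∧ ¬ Conn ends ω' a₂ c ∧ Conn ends ω'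 a₂ b ∧ ¬ Conn ends ω' c b}} + prob p {ω : Config E | inn ω ∈ {ω' : Config E | ¬ Conn ends ω' u a₂ ∧ ¬ Conn ends ω' u c ∧ ¬ Conn ends ω' u b ∧ ¬ Conn ends ω' a₂ c ∧ ¬ Conn ends ω' a₂ b ∧ ¬ Conn ends ω' c b}} + prob p {ω : Config E | inn ω ∈ {ω' : Config E | ¬ Conn ends ω' u a₂ ∧ ¬ Conn ends ω' u c ∧ ¬ Conn ends ω' u b ∧ ¬ Conn ends ω' a₂ c ∧ ¬ Conn ends ω' a₂ b ∧ Conn ends ω' c b}} := by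
  have hset : {ω : Config E | inn ω ∈ {ω' : Config E | ¬ Conn ends ω' u a₂ ∧ ¬ Conn ends ω' u c} ∩ {ω' : Config E | ¬ Conn ends ω' u a₂ ∧ ¬ Conn ends ω' a₂ c}} = {ω : Config E | inn ω ∈ {ω' : Config E | ¬ Conn ends ω' u a₂ ∧ ¬ Conn ends ω' u c ∧ Conn ends ω' u b ∧ ¬ Conn ends ω' a₂ c ∧ ¬ Conn ends ω' a₂ b ∧ ¬ Conn ends ω' c b}} ∪ ({ω : Config E | inn ω ∈ {ω' : Config E | ¬ Conn ends ω' u a₂ ∧ ¬ Conn ends ω' u c ∧ ¬ Conn ends ω' u b ∧ ¬ Conn ends ω' a₂ c ∧ Conn ends ω' a₂ b ∧ ¬ Conn ends ω' c b}} ∪ ({ω : Config E | inn ω ∈ {ω' : Config E | ¬ Conn ends ω' u a₂ ∧ ¬ Conn ends ω' u c ∧ ¬ Conn ends ω' u b ∧ ¬ Conn ends ω' a₂ c ∧ ¬ Conn ends ω' a₂ b ∧ ¬ Conn ends ω' c b}} ∪ ({ω : Config E | inn ω ∈ {ω' : Config E | ¬ Conn ends ω' u a₂ ∧ ¬ Conn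 ends ω' u c ∧ ¬ Conn ends ω' u b ∧ ¬ Conn ends ω' a₂ c ∧ ¬ Conn ends ω' a₂ b ∧ Conn ends ω' c b}}))) := by
    ext ω
    simp only [Set.mem_setOf_eq, Set.mem_union, Set.mem_inter_iff]
    constructor
    · intro h
      rcases PocketAtoms.atoms_cover ends u a₂ c b (inn ω) with hk|hk|hk|hk|hk|hk|hk|hk|hk|hk|hk|hk|hk|hk|hk
      · exact absurd hk.1 h.1.1
      · exact absurd hk.2.1 h.1.2
      · exact absurd hk.1 h.1.1
      · exact absurd hk.2.2.2.1 h.2.2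
      · exact Or.inr (Or.inr (Or.inr (hk)))
      · exact absurd hk.1 h.1.1
      · exact absurd hk.2.1 h.1.2
      · exact absurd hk.2.1 h.1.2
      · exact absurd hk.2.2.2.1 h.2.2
      · exact absurd hk.1 h.1.1
      · exact Or.inl (hk)
      · exact absurd hk.1 h.1.1
      · exact absurd hk.2.2.2.1 h.2.2
      · exact Or.inr (Or.inl (hk))
      · exact Or.inr (Or.inr (Or.inl (hk)))
    · rintro (hk|hk|hk|hk)
      · exact ⟨⟨hk.1, hk.2.1⟩, ⟨hk.1, hk.2.2.2.1⟩⟩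
      · exact ⟨⟨hk.1, hk.2.1⟩, ⟨hk.1, hk.2.2.2.1⟩⟩
      · exact ⟨⟨hk.1, hk.2.1⟩, ⟨hk.1, hk.2.2.2.1⟩⟩
      · exact ⟨⟨hk.1, hk.2.1⟩, ⟨hk.1, hk.2.2.2.1⟩⟩
  rw [hset]
  rw [prob_union_of_disjoint p (by
    rw [Set.disjoint_left]
    intro ω h1 h2
    simp only [Set.mem_setOf_eq, Set.mem_union] at h1 h2
    rcases h2 with h2|h2|h2
    · exact absurd h1.2.2.1 h2.2.2.1
    · exact absurd h1.2.2.1 h2.2.2.1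
    · exact absurd h1.2.2.1 h2.2.2.1
    )]
  rw [prob_union_of_disjoint p (by
    rw [Set.disjoint_left]
    intro ω h1 h2
    simp only [Set.mem_setOf_eq, Set.mem_union] at h1 h2
    rcases h2 with h2|h2
    · exact absurd h1.2.2.2.2.1 h2.2.2.2.2.1
    · exact absurd h1.2.2.2.2.1 h2.2.2.2.2.1
    )]
  rw [prob_union_of_disjoint p (by
    rw [Set.disjoint_left]
    intro ω h1 h2
    simp only [Set.mem_setOf_eq] at h1 h2
    exact absurd h2.2.2.2.2.2 h1.2.2.2.2.2
    )]
  ring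

end PocketBridge

end RootLeafU

end Summit.Ventures.PercRepro2
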